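import Literature.Computability.AlgebraicComplexity.RankClassSubstitutionStep
import Summits.MatrixMultiplication.OmegaCensus.SmallFormats.RankOnePlaneCapQuant
import Summits.MatrixMultiplication.OmegaCensus.SmallFormats.GF2OrbitSweep
import Literature.Computability.AlgebraicComplexity.SmallFormatMatMulRankUpper
import HarnessLib

/-!
# ω-census family (a) / cell pub-mm22, H-E3: `R_𝔽₂(⟨2,3,4⟩) ≥ 20 ⟸ Cert 2 3 4 [10] 19` (kernel implication)

Cell `pub-mm22` (MatrixMultiplication venture; HOME `run/shared/lean/pub/pub-mm22/`; seat LIT-2 g9, on the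
lead's word 2026-08-22T22:36:48Z), topic `Summits/MatrixMultiplication/OmegaCensus` (sub-folder
`SmallFormats`, next to the plane cap `RankOnePlaneCapQuant.lean` and the `⟨2,3,4⟩` sweep `GF2Rank234Cert.lean`).
HONEST FRAMING: a CONDITIONAL kernel object, not a result.  It proves the implication
"every bilinear computation of `⟨2,3,4⟩` over `𝔽₂` with the first factor constrained to Wang's orbit
`[10]` = `{X ∈ 𝔽₂^{2×3} : X₀₁ + X₁₀ = 0}` has at least `19` products (`Cert 2 3 4 [10] 19`, the cell's
step [δ]; the tree's kernel value for this orbit is `18`, `GF2Rank234Os` orbit 29) ⇒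
`20 ≤ R_𝔽₂(⟨2,3,4⟩)`", i.e. steps [α] (plane cap `card_le_234_at19`: at most `4` first forms of a
19-term computation vanish on a plane `{λ zᵀ}`, hence at most `12` have a coefficient matrix of rank
`≤ 1`), [β] (transport of a rank-two first form to `E₀₁ + E₁₀` by `GL₂ × GL₃`) and [γ] (killing it by
the constraint `X₀₁ + X₁₀ = 0`) of the cell's E3 chain, with [β][γ] the field-independent Literature
theorems of `Literature/Computability/AlgebraicComplexity/RankClassSubstitutionStep.lean`
(Nazarov 2023 Lemmas 5–6, Wang 2026 Lemmas 1 and 3).  The antecedent [δ] is NOT a kernel theorem: it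
is the cell's computer-assisted, referee-checked statement (routes (1) vsp enumeration, (2) profile
reduction + realizability certificates, (3) e3vs5; HOME `certificates/E3/`).  With the tree's
`tensorRank_matMulTensor_234_le` (Hopcroft–Kerr 1971, `≤ 20`) the consequent reads
`R_𝔽₂(⟨2,3,4⟩) = 20` — conditionally on [δ].  Nothing here is progress on `ω`.
-/

namespace Summit.MatrixMultiplication.OmegaCensus.GF2RankLB.E3

open Summit.MatrixMultiplication.OmegaCensus.GF2RankLB
open Summit.MatrixMultiplication.OmegaCensus.RankOnePlaneCapGeneral
open Literature.Computability.AlgebraicComplexity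
open Literature.Computability.AlgebraicComplexity.RankClassSubstitution
open Module Matrix

section PlaneCounting

variable {k : Type*} [Field k] {c m n : ℕ} {ι : Type*} [Fintype ι]

/-- The first form on a rank-one matrix: `f_t(λ zᵀ) = ∑_l z_l (λ A_t)_l`.
[cite: Nazarov2023FiniteFieldLB, §3 (2) (the coefficient matrices `A_t`)] -/
theorem f_vecMulVec (β : BilinComp (mulBilin k c m n) ι) (t : ι) (lam : Fin c → k)
    (z : Fin m → k) :
    β.f t (Matrix.vecMulVec lam z) = ∑ l, z l * (lam ᵥ* Nazarov2023.An β t) l := by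
  rw [Nazarov2023.fn_eq_sum, Finset.sum_comm]
  refine Finset.sum_congr rfl fun l _ => ?_
  simp only [Matrix.vecMul, dotProduct, Matrix.vecMulVec_apply, Finset.mul_sum]
  exact Finset.sum_congr rfl fun i _ => by ring

/-- **A rank-deficient first form vanishes on a rank-one plane**: if `rank A_t < c` there is
`λ ≠ 0` with `λ A_t = 0`, and then `f_t(λ zᵀ) = 0` for all `z ∈ k^m` (for `c = 2`: a product whose
`X`-form has rank `≤ 1` is supported on one of the planes `{λ zᵀ}`). [folklore] -/
theorem exists_plane_of_rank_lt (β : BilinComp (mulBilin k c m n) ι) (t : ι)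
    (h : (Nazarov2023.An β t).rank < c) :
    ∃ lam : Fin c → k, lam ≠ 0 ∧ ∀ z : Fin m → k, β.f t (Matrix.vecMulVec lam z) = 0 := by
  set A := Nazarov2023.An β t with hA
  have hlt : finrank k (LinearMap.range Aᵀ.mulVecLin) < c := by
    have e : Aᵀ.rank = A.rank := Matrix.rank_transpose A
    have e' : Aᵀ.rank = finrank k (LinearMap.range Aᵀ.mulVecLin) := rfl
    omega
  have hker : LinearMap.ker Aᵀ.mulVecLin ≠ ⊥ := by
    intro hbot
    have h1 := LinearMap.finrank_range_add_finrank_ker Aᵀ.mulVecLin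
    rw [hbot, finrank_bot, add_zero, Module.finrank_fin_fun] at h1
    omega
  obtain ⟨lam, hmem, hne⟩ := Submodule.exists_mem_ne_zero_of_ne_bot hker
  refine ⟨lam, hne, fun z => ?_⟩
  have hvm : lam ᵥ* A = 0 := by
    rw [← Matrix.mulVec_transpose, ← Matrix.mulVecLin_apply]
    exact LinearMap.mem_ker.1 hmem
  rw [f_vecMulVec, ← hA, hvm]
  simp

/-- **Counting over the planes (finite field)**: if on every plane `{λ zᵀ : z}` (`λ ∈ k^c ∖ 0`) at
most `N₁` first forms vanish, then at most `(q^c − 1) · N₁` products have a coefficient matrix of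
rank `< c` (`q = |k|`; each such product lies on the plane of some `λ ≠ 0`). [folklore] -/
theorem card_le_of_forall_rank_lt [Fintype k] [DecidableEq k] (β : BilinComp (mulBilin k c m n) ι)
    {N₁ : ℕ}
    (hcap : ∀ lam : Fin c → k, lam ≠ 0 → ∀ R : Finset ι,
      (∀ t ∈ R, ∀ z : Fin m → k, β.f t (Matrix.vecMulVec lam z) = 0) → R.card ≤ N₁)
    (T : Finset ι) (hT : ∀ t ∈ T, (Nazarov2023.An β t).rank < c) :
    T.card ≤ (Fintype.card k ^ c - 1) * N₁ := by
  classical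
  let L : Finset (Fin c → k) := Finset.univ.erase 0
  let V : (Fin c → k) → Finset ι :=
    fun lam => T.filter (fun t => ∀ z : Fin m → k, β.f t (Matrix.vecMulVec lam z) = 0)
  have hsub : T ⊆ L.biUnion V := by
    intro t ht
    obtain ⟨lam, hne, hvan⟩ := exists_plane_of_rank_lt β t (hT t ht)
    exact Finset.mem_biUnion.2
      ⟨lam, Finset.mem_erase.2 ⟨hne, Finset.mem_univ _⟩, Finset.mem_filter.2 ⟨ht, hvan⟩⟩
  have hL : L.card = Fintype.card k ^ c - 1 := by
    rw [Finset.card_erase_of_mem (Finset.mem_univ _), Finset.card_univ, Fintype.card_fun,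
      Fintype.card_fin]
  calc T.card ≤ (L.biUnion V).card := Finset.card_le_card hsub
    _ ≤ ∑ lam ∈ L, (V lam).card := Finset.card_biUnion_le
    _ ≤ ∑ lam ∈ L, N₁ := Finset.sum_le_sum fun lam hlam =>
        hcap lam (Finset.mem_erase.1 hlam).1 _ (fun t ht => (Finset.mem_filter.1 ht).2)
    _ = (Fintype.card k ^ c - 1) * N₁ := by rw [Finset.sum_const, smul_eq_mul, hL]

end PlaneCounting

/-- Membership in Wang's orbit-`[10]` subspace of `𝔽₂^{2×3}` gives `X₀₁ + X₁₀ = 0`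
(bit pattern `10 = 2¹ + 2³`, positions `(0,1) ↦ 1`, `(1,0) ↦ 3`). -/
theorem add_eq_zero_of_mem_subOf10 (x : Matrix (Fin 2) (Fin 3) (ZMod 2)) (hx : x ∈ subOf 2 3 [10]) :
    x 0 1 + x 1 0 = 0 := by
  have h := (mem_constrSub.1 hx) (form 2 3 10) (by simp)
  have hb : ∀ p : ℕ, p < 6 → (Nat.testBit 10 p = true ↔ (p = 1 ∨ p = 3)) := by decide
  rw [form_apply] at h
  simp only [Fin.sum_univ_two, Fin.sum_univ_three, pos] at h
  simpa [hb] using h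

/-- **H-E3 ⟸ [δ]** (cell pub-mm22): if every bilinear computation of `⟨2,3,4⟩` over `𝔽₂` with the
first factor constrained to `{X : X₀₁ + X₁₀ = 0}` (Wang's orbit `[10]`) has at least `19` products,
then `R_𝔽₂(⟨2,3,4⟩) ≥ 20`.  Proof: an optimal computation has `R ≥ 19` products (restrict it to the
subspace); if `R = 19`, the plane cap [α] `card_le_234_at19` leaves at most `3 · 4 = 12` products with a
first form of rank `≤ 1`, so some product has a rank-two form, which [β] is moved to `E₀₁ + E₁₀` and
[γ] killed by `X₀₁ + X₁₀ = 0`, leaving `18 < 19` products on the subspace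
(`RankClassSubstitution.succ_le_card_of_rank_two`). -/
theorem twenty_le_rank234_of_cert10 (h : Cert 2 3 4 [10] 19) :
    20 ≤ tensorRank (matMulTensor (ZMod 2) 2 3 4) := by
  classical
  by_contra hlt
  rw [not_le] at hlt
  obtain ⟨β⟩ := exists_bilinComp_of_tensorRank_le (k := ZMod 2) (c := 2) (m := 3) (n := 4) le_rfl
  set R := tensorRank (matMulTensor (ZMod 2) 2 3 4) with hR
  have hS : ∀ x ∈ subOf 2 3 [10], x 0 1 + x 1 0 = 0 := add_eq_zero_of_mem_subOf10
  have hb : ∀ r, BilinComp ((mulBilin (ZMod 2) 2 3 4).comp (subOf 2 3 [10]).subtype) (Fin r) →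
      19 ≤ r := h
  -- `R ≥ 19`: restrict an optimal computation to the subspace
  have h19 : 19 ≤ R := by
    have := hb R (β.restrictSub (subOf 2 3 [10]))
    simpa using this
  have hR19 : Fintype.card (Fin R) = 19 := by rw [Fintype.card_fin]; omega
  -- [α]: the plane cap at length 19
  have hcap : ∀ lam : Fin 2 → ZMod 2, lam ≠ 0 → ∀ T : Finset (Fin R),
      (∀ t ∈ T, ∀ z : Fin (1 + 2) → ZMod 2, β.f t (Matrix.vecMulVec lam z) = 0) → T.card ≤ 4 :=
    fun lam hlam T hT => (card_le_234_at19 hR19 β hlam T ∅ hT (by simp)).1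
  -- [α]: hence at most `3 · 4 = 12 < 19` products have a first form of rank `≤ 1`
  have hex : ∃ t : Fin R, ¬ (Nazarov2023.An β t).rank < 2 := by
    by_contra hall
    simp only [not_exists, not_not] at hall
    have hc := card_le_of_forall_rank_lt β hcap Finset.univ (fun t _ => hall t)
    rw [Finset.card_univ, hR19, ZMod.card] at hc
    omega
  obtain ⟨t, ht⟩ := hex
  have hrk : (Nazarov2023.An β t).rank = 2 := le_antisymm (Matrix.rank_le_height _) (not_lt.1 ht)
  -- [β][γ]: move that product's form to `E₀₁ + E₁₀` and kill it by `X₀₁ + X₁₀ = 0`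
  have h20 := succ_le_card_of_rank_two (m := 1) (n := 4) (subOf 2 3 [10]) hS hb β t hrk
  rw [hR19] at h20
  omega

/-- The conditional exact value: [δ] ⇒ `R_𝔽₂(⟨2,3,4⟩) = 20` (upper bound: the Hopcroft–Kerr 1971
scheme, tree `tensorRank_matMulTensor_234_le`). -/
theorem rank234_eq_twenty_of_cert10 (h : Cert 2 3 4 [10] 19) :
    tensorRank (matMulTensor (ZMod 2) 2 3 4) = 20 :=
  le_antisymm (tensorRank_matMulTensor_234_le (ZMod 2)) (twenty_le_rank234_of_cert10 h)

end Summit.MatrixMultiplication.OmegaCensus.GF2RankLB.E3
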